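import Summits.QuantumFields.YangMills.Theorems.LuscherReductionTwistedTraceScalingBODefectHOD
import Summits.QuantumFields.YangMills.Theorems.LuscherReductionTwistedTraceScalingBTProfileRecord
import Summits.QuantumFields.YangMills.Theorems.LuscherReductionTwistedTraceScalingBTProfileAssembly
import HarnessLib

/-!
# (C4-CORE, analytic input modulo (B-ST)) `RecordAnalyticInput L s M` FROM THE STABILITY BRICK ALONE, for the cap-restricted frozen stiff-Gaussian profile, `1/6 < s < 1/4`
# (lane A of S-BASE, crux `TwistedTraceScaling` stmt-QuantumFields-20203, C4-CORE; `pub/ym-fleet/ym-luscher-20007-p1/HANDOFF-g20.md`)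

With the (OD) brick `…BODefectHOD.hOD_record` in the tree, the structural fields of `…BTProfileRecord.recordAnalyticInput_of_profile` for
`Ω_c = 𝟙_cap·frozenProfile(stiffGauss, r_B)` are routine (`…BOCapProfile`, `…BTFibreProfile`; the cap-balanced set has full `π`-measure, so `∫Ω_c = ∫Ω` and `γ(Ω_c) = γ(Ω)`):
★★★ `recordAnalyticInput_of_hST` — for `L ≥ 2` with a non-zero site and `1/6 < s < 1/4` there is `M₀` such that for every `M ≥ M₀` and `θ₀ ∈ (0,1]`, the (ST) brick `hST`
(eventually in `β`: `tubeForm β v ≤ (1−θ₀)·((btC/fpZ/γ)·λ₀)·T(v)` for bounded measurable `v` supported in `{χ ≠ 0}` and `⊥` the BO fibres of `Ω_c`) ALONE gives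
`Nonempty (RecordAnalyticInput L s M)`.
HONEST FRAMING: the analytic input of the CONDITIONAL route R2b1 modulo its (ST) half (other lane, OPEN); C4-CORE's target and the route's named gaps remain OPEN; not a gap, not Clay.
-/

set_option autoImplicit false

noncomputable section

open MeasureTheory Filter Topology Real
open scoped BigOperators
open Literature.MathematicalPhysics.QuantumFieldTheory
open Literature.MathematicalPhysics.QuantumLattice

namespace Summit.QuantumFields.YangMills.Theorems.FemtoTransferGap.TwoLattice.ConstTube

open Summit.QuantumFields.YangMills.Theorems.FemtoTransferGap
open Summit.QuantumFields.YangMills.Theorems.FemtoTransferGap.TwoLattice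
open Summit.QuantumFields.YangMills.Theorems.FemtoTransferGap.TwoLattice.Avg
open Summit.QuantumFields.YangMills.Theorems.FemtoTransferGap.TwoLattice.Stiff
open Summit.QuantumFields.YangMills.Theorems.FemtoTransferGap.TwoLattice.GnChart
open Summit.QuantumFields.YangMills.Theorems.FemtoTransferGap.TwoLattice.Cov

variable {L : ℕ} [NeZero L]

/-- `π`-a.e. the cap indicator at `linkEmbed v` is `1`. [folklore] -/
theorem ae_capLink_indicator_linkEmbed :
    ∀ᵐ v ∂orthoTransverse L, {x : LinkSpace L | linkCurry x ∈ capBalancedSet L}.indicator (fun _ => (1 : ℝ)) (linkEmbed L v) = 1 := by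
  have hcapπ : ∀ᵐ v ∂orthoTransverse L, v ∈ capBalancedSet L := by
    rw [ae_iff]; have h0 := orthoTransverse_compl_capBalancedSet L; simpa only [Set.compl_def] using h0
  filter_upwards [hcapπ] with v hv
  rw [Set.indicator_of_mem ((linkEmbed_mem_capLink_iff v).2 hv)]

/-- `∫ Ω_c(linkEmbed v) dπ = ∫ Ω(linkEmbed v) dπ`. [folklore] -/
theorem integral_capRestrict_linkEmbed (Ω : LinkSpace L → ℝ) :
    ∫ v, {x : LinkSpace L | linkCurry x ∈ capBalancedSet L}.indicator (fun _ => (1 : ℝ)) (linkEmbed L v) * Ω (linkEmbed L v) ∂orthoTransverse L =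
      ∫ v, Ω (linkEmbed L v) ∂orthoTransverse L := by
  refine integral_congr_ae ?_
  filter_upwards [ae_capLink_indicator_linkEmbed (L := L)] with v hv
  rw [hv, one_mul]

/-- `γ(Ω_c) = γ(Ω)` for any profile family `Ω`. [folklore] -/
theorem recordGamma_capRestrict (Ω : ℝ → LinkSpace L → ℝ) (β : ℝ) :
    recordGamma L (fun β' => fun x : LinkSpace L => {x : LinkSpace L | linkCurry x ∈ capBalancedSet L}.indicator (fun _ => (1 : ℝ)) x * Ω β' x) β = recordGamma L Ω β := by
  unfold recordGamma boGamma
  congr 1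
  refine integral_congr_ae ?_
  filter_upwards [ae_capLink_indicator_linkEmbed (L := L)] with v hv
  simp only [hv, one_mul]

set_option maxHeartbeats 1600000 in
-- large record expressions.
/-- ★★★ **`RecordAnalyticInput` FROM (B-ST) ALONE** (see the module docstring). [cite: Luscher1983, §3] [cite: SjostrandZworski2007, §2] -/
theorem recordAnalyticInput_of_hST (hLz : Nonempty (NzSite L)) (hL2 : 2 ≤ L) {s : ℝ} (hs6 : 1 / 6 < s) (hs4 : s < 1 / 4) :
    ∃ M₀ : ℝ, 2 ≤ M₀ ∧ ∀ M : ℝ, M₀ ≤ M → ∀ θ₀ : ℝ, (0 < θ₀ ∧ θ₀ ≤ 1) →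
      (∀ᶠ β : ℝ in atTop, ∀ v : GaugeConfig 3 L SU2 → ℝ, Measurable v → (∃ C : ℝ, ∀ U, |v U| ≤ C) → (∀ U, v U ≠ 0 → (recordChi L s 43 M β) U ≠ 0) → (∀ u, fibreInner L (softWeight (recordChi L s 43 M β)) (fun x : LinkSpace L => {x : LinkSpace L | linkCurry x ∈ capBalancedSet L}.indicator (fun _ => (1 : ℝ)) x * frozenProfile L (fun β' => stiffGaussExp L (β' / 2) β') (fun β' => min (1 / 40) (powScale (1 / 2) β' * btLog β')) β x) v u = 0) → tubeForm β v ≤ (1 - θ₀) * ((btC L β (fun x : LinkSpace L => {x : LinkSpace L | linkCurry x ∈ capBalancedSet L}.indicator (fun _ => (1 : ℝ)) x * frozenProfile L (fun β' => stiffGaussExp L (β' / 2) β') (fun β' => min (1 / 40) (powScale (1 / 2) β' * btLog β')) β x) (btEps β) (5 * (powScale (1 / 2) β * btLog β ^ 2)) / fpZ (btEps β) / recordGamma L (fun β' => fun x : LinkSpace L => {x : LinkSpace L | linkCurry x ∈ capBalancedSet L}.indicator (fun _ => (1 : ℝ)) x * frozenProfile L (fun β'' => stiffGaussExp L (β'' /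 2) β'') (fun β'' => min (1 / 40) (powScale (1 / 2) β'' * btLog β'')) β' x) β) * levelValue su2Rep 1 ((L : ℝ) ^ 3 * β) 0) * tubeNormSq (softWeight (recordChi L s 43 M β)) v) → Nonempty (RecordAnalyticInput L s M) := by
  obtain ⟨M₀, hM₀, H⟩ := hOD_record (L := L) hLz hL2 hs6 hs4
  refine ⟨M₀, hM₀, fun M hM θ₀ hθ₀ hST => ?_⟩
  obtain ⟨b, hb, hbs, hOD⟩ := H M hM
  -- the structural fields of the cap-restricted frozen profile
  have hqfm : ∀ β', Measurable ((fun β' => stiffGaussExp L (β' / 2) β') β') := fun β' => measurable_stiffGaussExp _ _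
  have hqf0 : ∀ β' x, 0 ≤ (fun β' => stiffGaussExp L (β' / 2) β') β' x := fun β' x => stiffGaussExp_nonneg _ _ x
  have hqinv : ∀ β' (g : SU2) (x : LinkSpace L), (fun β' => stiffGaussExp L (β' / 2) β') β' (adL L g x) = (fun β' => stiffGaussExp L (β' / 2) β') β' x := fun β' g x => stiffGaussExp_adL _ _ g x
  have hr : ∀ β', 0 < (fun β' => min (1 / 40) (powScale (1 / 2) β' * btLog β')) β' := fun β' => lt_min (by norm_num) (mul_pos (powScale_pos _ _) (lt_of_lt_of_le one_pos (one_le_btLog β')))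
  obtain ⟨hFm, hF1, hFinv, hFr, hFγ⟩ := frozenProfile_fields (L := L) hqfm hqf0 hqinv hr
  have hF0 : ∀ β' x, 0 ≤ frozenProfile L (fun β' => stiffGaussExp L (β' / 2) β') (fun β' => min (1 / 40) (powScale (1 / 2) β' * btLog β')) β' x := fun β' x => (frozenProfile_mem_Icc hqf0 _ β' x).1
  have hΩm : ∀ β', Measurable ((fun β' => fun x : LinkSpace L => {x : LinkSpace L | linkCurry x ∈ capBalancedSet L}.indicator (fun _ => (1 : ℝ)) x * frozenProfile L (fun β'' => stiffGaussExp L (β'' / 2) β'') (fun β'' => min (1 / 40) (powScale (1 / 2) β'' * btLog β'')) β' x) β') := fun β' => measurable_capRestrict (L := L) (hFm β')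
  have hΩdat : ∀ β' x, 0 ≤ (fun β' => fun x : LinkSpace L => {x : LinkSpace L | linkCurry x ∈ capBalancedSet L}.indicator (fun _ => (1 : ℝ)) x * frozenProfile L (fun β'' => stiffGaussExp L (β'' / 2) β'') (fun β'' => min (1 / 40) (powScale (1 / 2) β'' * btLog β'')) β' x) β' x ∧ (fun β' => fun x : LinkSpace L => {x : LinkSpace L | linkCurry x ∈ capBalancedSet L}.indicator (fun _ => (1 : ℝ)) x * frozenProfile L (fun β'' => stiffGaussExp L (β'' / 2) β'') (fun β'' => min (1 / 40) (powScale (1 / 2) β'' * btLog β'')) β' x) β' x ≤ frozenProfile L (fun β' => stiffGaussExp L (β' / 2) β') (fun β' => min (1 / 40) (powScale (1 / 2) β' * btLog β')) β' x ∧ |(fun β' => fun x : LinkSpace L => {x : LinkSpace L | linkCurry x ∈ capBalancedSet L}.indicator (fun _ => (1 : ℝ)) x * frozenProfile L (fun β'' => stiffGaussExp L (β'' / 2) β'') (fun β'' => min (1 / 40) (powScale (1 / 2) β'' * btLog β'')) β' x) β' x| ≤ 1 :=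
    fun β' x => capRestrict_mem (L := L) (hF0 β') (hF1 β') x
  have hΩ1 : ∀ β' x, |(fun β' => fun x : LinkSpace L => {x : LinkSpace L | linkCurry x ∈ capBalancedSet L}.indicator (fun _ => (1 : ℝ)) x * frozenProfile L (fun β'' => stiffGaussExp L (β'' / 2) β'') (fun β'' => min (1 / 40) (powScale (1 / 2) β'' * btLog β'')) β' x) β' x| ≤ 1 := fun β' x => (hΩdat β' x).2.2
  have hΩ0 : ∀ β' x, 0 ≤ (fun β' => fun x : LinkSpace L => {x : LinkSpace L | linkCurry x ∈ capBalancedSet L}.indicator (fun _ => (1 : ℝ)) x * frozenProfile L (fun β'' => stiffGaussExp L (β'' / 2) β'') (fun β'' => min (1 / 40) (powScale (1 / 2) β'' * btLog β'')) β' x) β' x := fun β' x => (hΩdat β' x).1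
  have hΩinv : ∀ β' (g : SU2) (x : LinkSpace L), (fun β' => fun x : LinkSpace L => {x : LinkSpace L | linkCurry x ∈ capBalancedSet L}.indicator (fun _ => (1 : ℝ)) x * frozenProfile L (fun β'' => stiffGaussExp L (β'' / 2) β'') (fun β'' => min (1 / 40) (powScale (1 / 2) β'' * btLog β'')) β' x) β' (adL L g x) = (fun β' => fun x : LinkSpace L => {x : LinkSpace L | linkCurry x ∈ capBalancedSet L}.indicator (fun _ => (1 : ℝ)) x * frozenProfile L (fun β'' => stiffGaussExp L (β'' / 2) β'') (fun β'' => min (1 / 40) (powScale (1 / 2) β'' * btLog β'')) β' x) β' x := fun β' g x => capRestrict_adL (L := L) (fun g' x' => hFinv β' g' x') g x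
  have hΩr : ∀ β' x, (fun β' => fun x : LinkSpace L => {x : LinkSpace L | linkCurry x ∈ capBalancedSet L}.indicator (fun _ => (1 : ℝ)) x * frozenProfile L (fun β'' => stiffGaussExp L (β'' / 2) β'') (fun β'' => min (1 / 40) (powScale (1 / 2) β'' * btLog β'')) β' x) β' x ≠ 0 → ‖x‖ ≤ (fun β' => min (1 / 40) (powScale (1 / 2) β' * btLog β')) β' := fun β' x hx => hFr β' x (right_ne_zero_of_mul hx)
  have hI : ∀ β', 0 < ∫ v, (fun β' => fun x : LinkSpace L => {x : LinkSpace L | linkCurry x ∈ capBalancedSet L}.indicator (fun _ => (1 : ℝ)) x * frozenProfile L (fun β'' => stiffGaussExp L (β'' / 2) β'') (fun β'' => min (1 / 40) (powScale (1 / 2) β'' * btLog β'')) β' x) β' (linkEmbed L v) ∂orthoTransverse L := fun β' => by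
    have e := integral_capRestrict_linkEmbed (L := L) (frozenProfile L (fun β' => stiffGaussExp L (β' / 2) β') (fun β' => min (1 / 40) (powScale (1 / 2) β' * btLog β')) β')
    have h := integral_profile_pos (L := L) (hFm β') (hF1 β') (hF0 β') (hr β') (fun x hx => frozenProfile_ne_zero_of_norm_lt _ _ β' hx)
    simp only at e ⊢
    rw [e]; exact h
  have hγ : ∀ β', 0 < recordGamma L (fun β' => fun x : LinkSpace L => {x : LinkSpace L | linkCurry x ∈ capBalancedSet L}.indicator (fun _ => (1 : ℝ)) x * frozenProfile L (fun β'' => stiffGaussExp L (β'' / 2) β'') (fun β'' => min (1 / 40) (powScale (1 / 2) β'' * btLog β'')) β' x) β' := fun β' => by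
    rw [recordGamma_capRestrict (L := L)]; exact hFγ β'
  exact recordAnalyticInput_of_profile (L := L) (Ω := (fun β' => fun x : LinkSpace L => {x : LinkSpace L | linkCurry x ∈ capBalancedSet L}.indicator (fun _ => (1 : ℝ)) x * frozenProfile L (fun β'' => stiffGaussExp L (β'' / 2) β'') (fun β'' => min (1 / 40) (powScale (1 / 2) β'' * btLog β'')) β' x)) hs6 hs4.le hΩm hΩ1 hΩ0 hΩinv hΩr hI hγ hb hbs hθ₀ hST hOD

end Summit.QuantumFields.YangMills.Theorems.FemtoTransferGap.TwoLattice.ConstTube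

end
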